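import Summits.AtomisticToContinuum.FouriersLaw.Theses.VanishingNoiseTransfer
import Summits.AtomisticToContinuum.FouriersLaw.Theses.BondHeatUncertainty
import Literature.Barriers.AtomisticToContinuum.FixedLengthNoConductivityControl
import Summits.AtomisticToContinuum.FouriersLaw.Theorems.FourierGreenKuboFourierFiniteResponseOfUnique

/-!
# `VanishingNoiseBound` IS the bounded-response waypoint, transported by `NoiseLocality`

`--supports stmt-AtomisticToContinuum-11976` file (crux `VanishingNoiseBound`, route `VanishingNoiseTransfer`; line
`fekete-usc-one-length`, continuation lead c3, cycle 4). It pins the crux to ONE existing item of the sub-problem: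

* `vanishingNoiseBound_of_boundedResponse_of_noiseLocality` —
  `BondHeatUncertainty.BoundedResponse` (stmt-AtomisticToContinuum-11071, the shared waypoint
  `HasBoundedResponse (pinnedChain …)`: the finite-size conductivities `D_N(0)` of the DETERMINISTIC chain are bounded in
  `N`) together with the sibling crux `NoiseLocality` (stmt-11975) implies `VanishingNoiseBound`, with `K = 2B + 2`,
  `B` a bound of `|D_N(0)|` at `T`, and `ε₁ ≤ 1` chosen with `|w ε| ≤ 1/(2B + 2)`. Only the ONE-SIDED half
  `D_N(ε) − D_N(0) ≤ w(ε) |D_N(0)| |D_N(ε)|` of the modulus is used, and no positivity of any response.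
  This generalises the landed edge `vanishingNoiseBound_of_junctionLocality` (stmt-11748 ∧ stmt-9127 → bounded
  deterministic response by Fekete at one length) to ANY source of bounded response.
* `boundedResponse_of_vanishingNoiseBound` — conversely, `NoiseLocality ∧ VanishingNoiseBound ∧ NoisyFourier` give
  `BondHeatUncertainty.BoundedResponse`: the route's proved `closes` yields `FouriersLaw`, and Fourier's law forces
  bounded response (`Literature.Barriers.AtomisticToContinuum.hasBoundedResponse_of_fouriersLawFor`).
* `vanishingNoiseBound_iff_boundedResponse` — hence, GIVEN the two sibling cruxes `NoiseLocality` (stmt-11975) and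
  `NoisyFourier` (stmt-11977), `VanishingNoiseBound ↔ BondHeatUncertainty.BoundedResponse`: the crux carries exactly the
  `ε = 0` content catalogued as the barrier-blocked predicate `HasBoundedResponse` (`FixedLengthNoConductivityControl`),
  nothing noisy.
* `vanishingNoiseBound_of_fouriersLaw_of_noiseLocality` — the same edge with the conjunct itself as input (Fourier's law
  forces bounded response): the standing disprover's necessity lemma `Cruxes/VanishingNoiseBound/Disproof.lean §1b`,
  landed here as an importable theorem.

No `sorry`, no definitions, no named facts. Real analysis only.
-/

noncomputable section

open MeasureTheory Filter Topology
open Literature.MathematicalPhysics.KineticTheory.HeatConduction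

namespace Summit.AtomisticToContinuum.FouriersLaw.Theorems.VanishingNoiseBound

/-- **Bounded deterministic response + noise locality ⟹ the vanishing-noise bound.** For `pinnedChain ω₂ lam β γ`
(all `> 0`) and `T > 0`: along the unique deterministic steady family (landed existence + `NessUnique`, responses
`D_N(0)` from the closed `FiniteResponseOfUnique`), `BoundedResponse` (stmt-11071) gives `|D_N(0)| ≤ B` for all `N`;
the `N`-uniform modulus `w` of `NoiseLocality` (stmt-11975) with `|w ε| ≤ 1/(2B+2)` on `(0, ε₁]`, `ε₁ ≤ 1`, gives for
every flip rate `ε ∈ (0, ε₁]`, the unique noisy family and its responses `D_N(ε)`: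
`D_N(ε) − D_N(0) ≤ |w ε| |D_N(0)| |D_N(ε)| ≤ |D_N(ε)|/2`, hence `D_N(ε) ≤ 2B` for every `N` (trivial when
`D_N(ε) ≤ 0`), so every limit `k = lim_N D_N(ε)` satisfies `k ≤ 2B + 2 =: K`, uniformly in `ε`.
[cite: BonettoLebowitzReyBellet2000, §6.3] -/
theorem vanishingNoiseBound_of_boundedResponse_of_noiseLocality
    (hBR : Theses.BondHeatUncertainty.BoundedResponse)
    (hNL : Theses.VanishingNoiseTransfer.NoiseLocality) :
    Theses.VanishingNoiseTransfer.VanishingNoiseBound := by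
  intro ω₂ lam β γ hω hl hβ hγ S hS T hT
  have huniq := Theses.VanishingNoiseTransfer.NessUnique_holds ω₂ lam β γ hω hl hβ hγ
  -- (0) the unique deterministic steady family (landed existence theorem + NessUnique), by choice
  have hex : ∀ (N : ℕ) (T_L T_R : ℝ), 0 < T_L → 0 < T_R →
      ∃ μ : Measure (PhaseSpace N), (pinnedChain ω₂ lam β γ).IsSteadyState N T_L T_R μ :=
    fun N T_L T_R hL hR' => pinnedChain_exists_isSteadyState hω hl hβ hγ N hL hR'
  classical
  let μ0 : (N : ℕ) → ℝ → ℝ → Measure (PhaseSpace N) := fun N T_L T_R =>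
    if h : 0 < T_L ∧ 0 < T_R then Classical.choose (hex N T_L T_R h.1 h.2) else 0
  have hμ0 : ∀ (N : ℕ) (T_L T_R : ℝ), 0 < T_L → 0 < T_R →
      (pinnedChain ω₂ lam β γ).IsSteadyState N T_L T_R (μ0 N T_L T_R) := by
    intro N T_L T_R hL hR'
    simp only [μ0, dif_pos (And.intro hL hR')]
    exact Classical.choose_spec (hex N T_L T_R hL hR')
  -- its finite-`N` responses at `T` (FiniteResponseOfUnique, closed item stmt-0717)
  have hD0ex := Theorems.FourierGreenKubo.finiteResponse_of_unique ω₂ lam β γ hω hl hβ hγ huniq μ0 hμ0 T hT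
  choose D0 hD0 using hD0ex
  -- (1) BoundedResponse (stmt-11071): `|D_N(0)| ≤ B` for all `N`
  obtain ⟨B, hB⟩ := hBR ω₂ lam β γ hω hl hβ hγ μ0 hμ0 T hT D0 hD0
  have hBN : ∀ N : ℕ, |D0 N| ≤ B := fun N => hB ⟨N, rfl⟩
  have hB0 : 0 ≤ B := (abs_nonneg _).trans (hBN 0)
  have hA : (0 : ℝ) < 2 * B + 2 := by positivity
  -- (2) NoiseLocality (stmt-11975): the `N`-uniform modulus, `|w ε| < 1/(2B+2)` on a right neighbourhood of `0`
  obtain ⟨w, hw, hloc⟩ := hNL ω₂ lam β γ hω hl hβ hγ S hS T hT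
  have hsmall : ∀ᶠ ε in 𝓝[Set.Ioi (0 : ℝ)] 0, |w ε| < 1 / (2 * B + 2) := by
    have h := Metric.tendsto_nhds.1 hw (1 / (2 * B + 2)) (by positivity)
    refine h.mono fun ε hε' => ?_
    simpa [Real.dist_eq] using hε'
  rw [eventually_nhdsWithin_iff, Metric.eventually_nhds_iff] at hsmall
  obtain ⟨r, hr, hrw⟩ := hsmall
  subst hS
  refine ⟨2 * B + 2, min (r / 2) 1, lt_min (by linarith) one_pos, ?_⟩
  intro ε hε hεle μ hμ D k hD hk
  have hεr : ε ≤ r / 2 := hεle.trans (min_le_left _ _)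
  have hε1 : ε ≤ 1 := hεle.trans (min_le_right _ _)
  have hwε : |w ε| < 1 / (2 * B + 2) := by
    refine hrw ?_ (Set.mem_Ioi.2 hε)
    rw [Real.dist_eq, sub_zero, abs_of_pos hε]
    linarith
  -- transfer at each length `N`: `|D_N(0) − D_N(ε)| ≤ w ε |D_N(0)| |D_N(ε)|`
  have hN : ∀ N : ℕ, |D0 N - D N| ≤ w ε * |D0 N| * |D N| := fun N =>
    hloc N ε hε hε1 (μ0 N) (μ N)
      (fun T_L T_R hL hR' => ⟨hμ0 N T_L T_R hL hR',
        fun ν hν => huniq N T_L T_R hL hR' ν _ hν (hμ0 N T_L T_R hL hR')⟩)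
      (fun T_L T_R hL hR' => hμ N T_L T_R hL hR') (D0 N) (D N) (hD0 N) (hD N)
  -- hence `D_N(ε) ≤ 2B + 2` for every `N`
  have hle : ∀ N : ℕ, D N ≤ 2 * B + 2 := by
    intro N
    by_cases hDN : D N ≤ 0
    · linarith
    · have hDN : 0 < D N := not_le.mp hDN
      have h1 := hN N
      -- `D N - D0 N ≤ |w ε| |D0 N| |D N| ≤ (1/(2B+2)) · B · D N ≤ D N / 2`
      have h2 : D N - D0 N ≤ |w ε| * |D0 N| * |D N| := by
        have h3 : D N - D0 N ≤ |D0 N - D N| := by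
          rw [abs_sub_comm]
          exact le_abs_self _
        refine h3.trans (h1.trans ?_)
        gcongr
        exact le_abs_self _
      rw [abs_of_pos hDN] at h2
      have h4 : |w ε| * |D0 N| * D N ≤ 1 / (2 * B + 2) * B * D N := by
        have h5 : |w ε| * |D0 N| ≤ 1 / (2 * B + 2) * B :=
          mul_le_mul hwε.le (hBN N) (abs_nonneg _) (by positivity)
        exact mul_le_mul_of_nonneg_right h5 hDN.le
      have h6 : 1 / (2 * B + 2) * B ≤ 1 / 2 := by
        rw [div_mul_eq_mul_div, one_mul, div_le_iff₀ hA]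
        linarith
      have h7 : 1 / (2 * B + 2) * B * D N ≤ 1 / 2 * D N := mul_le_mul_of_nonneg_right h6 hDN.le
      have h8 : D0 N ≤ B := (le_abs_self _).trans (hBN N)
      linarith
  exact le_of_tendsto' hk hle

/-- **The converse edge.** `NoiseLocality ∧ VanishingNoiseBound ∧ NoisyFourier ⟹ BoundedResponse` (stmt-11071): the
route's deciding theorem `Theses.VanishingNoiseTransfer.closes` (with the closed supports `NessUnique`,
`FiniteResponseOfUnique` discharged) gives `FouriersLaw`, and Fourier's law for a chain forces a length-uniform bound on
its finite-size conductivities (`hasBoundedResponse_of_fouriersLawFor`; `BoundedResponse` is the catalogued predicate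
`HasBoundedResponse (pinnedChain …)` with its definiens written out, `Iff.rfl`). [cite: BonettoLebowitzReyBellet2000, §6.3] -/
theorem boundedResponse_of_vanishingNoiseBound
    (hNL : Theses.VanishingNoiseTransfer.NoiseLocality)
    (hVB : Theses.VanishingNoiseTransfer.VanishingNoiseBound)
    (hNF : Theses.VanishingNoiseTransfer.NoisyFourier) :
    Theses.BondHeatUncertainty.BoundedResponse := by
  intro ω₂ lam β γ hω hl hβ hγ
  have hFL : _root_.FouriersLaw :=
    Theses.VanishingNoiseTransfer.closes hNL hVB hNF Theses.VanishingNoiseTransfer.NessUnique_holds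
      Theorems.FourierGreenKubo.finiteResponse_of_unique
  exact Literature.Barriers.AtomisticToContinuum.hasBoundedResponse_of_fouriersLawFor (hFL ω₂ lam β γ hω hl hβ hγ)

/-- **The crux is the bounded-response waypoint, modulo its two sibling cruxes.** Given `NoiseLocality` (stmt-11975)
and `NoisyFourier` (stmt-11977), `VanishingNoiseBound` (stmt-11976) is EQUIVALENT to `BondHeatUncertainty.BoundedResponse`
(stmt-11071, `= HasBoundedResponse (pinnedChain …)` for all parameters): the `ε`-uniform bound on the noisy
conductivities carries exactly the deterministic `N`-uniform bound on `D_N(0)` and nothing else.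
[cite: BonettoLebowitzReyBellet2000, §6.3] -/
theorem vanishingNoiseBound_iff_boundedResponse
    (hNL : Theses.VanishingNoiseTransfer.NoiseLocality)
    (hNF : Theses.VanishingNoiseTransfer.NoisyFourier) :
    Theses.VanishingNoiseTransfer.VanishingNoiseBound ↔ Theses.BondHeatUncertainty.BoundedResponse :=
  ⟨fun hVB => boundedResponse_of_vanishingNoiseBound hNL hVB hNF,
    fun hBR => vanishingNoiseBound_of_boundedResponse_of_noiseLocality hBR hNL⟩

/-- **No slack (the disprover's necessity lemma, landed).** `FouriersLaw ∧ NoiseLocality → VanishingNoiseBound`: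
Fourier's law forces bounded response (`hasBoundedResponse_of_fouriersLawFor`), and the edge above applies. So, modulo
the sibling `NoiseLocality`, refuting the crux inside `0 < ω₂, lam, β, γ` means refuting the conjunct itself.
[cite: BonettoLebowitzReyBellet2000, §6.3] -/
theorem vanishingNoiseBound_of_fouriersLaw_of_noiseLocality
    (hFL : _root_.FouriersLaw) (hNL : Theses.VanishingNoiseTransfer.NoiseLocality) :
    Theses.VanishingNoiseTransfer.VanishingNoiseBound :=
  vanishingNoiseBound_of_boundedResponse_of_noiseLocality
    (fun ω₂ lam β γ hω hl hβ hγ =>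
      Literature.Barriers.AtomisticToContinuum.hasBoundedResponse_of_fouriersLawFor (hFL ω₂ lam β γ hω hl hβ hγ))
    hNL

/-- Registered helper sub-goal `helper_vanishingNoiseBoundOfBoundedResponse` of crux stmt-AtomisticToContinuum-11976 (line
`fekete-usc-one-length`, c3): the edge `BoundedResponse → NoiseLocality → VanishingNoiseBound`
(`vanishingNoiseBound_of_boundedResponse_of_noiseLocality`). -/
theorem helper_vanishingNoiseBoundOfBoundedResponse :
    Theses.BondHeatUncertainty.BoundedResponse → Theses.VanishingNoiseTransfer.NoiseLocality →
      Theses.VanishingNoiseTransfer.VanishingNoiseBound :=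
  vanishingNoiseBound_of_boundedResponse_of_noiseLocality

end Summit.AtomisticToContinuum.FouriersLaw.Theorems.VanishingNoiseBound

end
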